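import Summits.BirchSwinnertonDyer.Rank1Residual.AdditivePotMult.PotMultCongruentPairGVBudgetRank
import Summits.BirchSwinnertonDyer.Rank1Residual.AdditivePotMult.PotMultX3BudgetRankZeroEnds
import HarnessLib

/-!
# Rank-`0` `BSD(E,p)` ENDS on the (M) rows from a GV congruent partner of enough RANK — X3♯(M)
# reducible pairs with NEITHER the congruence schema NOR a partner certificate as a hypothesis, and
# the EPW-free second source on X4(M) (cell `b2b-bsdres`, team n1011, seat p07 (gen 6); OWNERS row
# T-E3d-GV FILE 3; sequel of `PotMultCongruentPairGVBudgetRank.lean`, of n1011-p12's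
# `PotMultX3BudgetRankZeroEnds` and of p07-g3's `PotMultBudgetRankZeroEnds`)

HONEST FRAMING (cell `b2b-bsdres`, run/shared/lean/b2b/bsd-rank1-residual/, verbatim in every
file): the goal of the cell is to DELETE the COMBINATION-SHAPED residual classes of the
Birch–Swinnerton-Dyer formula for ALL analytic-rank `≤ 1` elliptic curves over `ℚ` — "full BSD
formula for every rank `≤ 1` curve in class `C`" assembled STRICTLY from published theorems — so
that the rank-`≤ 1` remainder becomes exactly the CONSTRUCTION-SHAPED classes, which are TYPED
(missing-input `Prop`s), NOT attempted. This is not "finishing BSD". Team n1011 (RESIDUAL-MAP §I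
N10 / N11 LOWER half on the (M) rows = X3♯(M) / X4(M) ∧ surj(p), `r_an = 0`, every odd `p` incl.
`3`): research route on CONSTRUCTION-SHAPED items; labels and marks UNCHANGED; nothing booked — every
statement below is PER PAIR modulo the named facts AND per-pair inputs outside the kernel (the
first-unit-index record = CERTIFICATE-EVIDENCE, two-engine rule; the congruence = census `TorsionIso`
currency; `Σ₀`; the partner's rank; on X3 one census torsion bit); booking = director, per pair,
after countersign. Theorems only; NO definition; NO Literature fact minted. Named facts enter as
HYPOTHESES exactly as in the consumed ends, none dropped: `hW16` (Wuthrich 2014 Thm. 16, X3♯), `hK`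
(Kato 2004 Thm. 17.4 (3), X4), `hDel`/`hDelX` (Delbourgo 1998 Prop. 4, (M) exact form), `hPal` (Pal
2012 Thm. 3.2, even branch only), `hGZK`, `hmod`, `hmodD`, and for the GV budget `hGV` (GV §2 composed
record), `hT40`/`hT41` (A40/A41), `hGrK` (A239, (G-ord) partner only). Debt 0.

## What

The rank-`0` ends `ClassX3M.bsdp[_three]_rankZero_of_wuthrichHalf_of_firstUnitIndex_of_budget[_odd]`
(p12) and `ClassX4M.bsdp[_three]_rankZero_of_surj_of_katoHalf_of_firstUnitIndex_of_budget` (p07-g3)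
take n1011-p10's typed budget `BudgetLeLambdaAt p W b` at the index `b` of the record. FILE 2
produces that budget from a GV congruent partner of rank `≥ r₁`. Composed here:
* §1 X3♯(M) ∧ `r_an = 0` row with an X3♯(M) partner (`…_of_gv_of_x3Partner`, `_odd` = Pal-free at
  `p ≡ 3 (mod 4)`, `_three` at `p = 3`) or an X3♯(G-ord) ∩ `I₀*` partner (`…_of_gv_of_x3GordPartner[…]`):
  compared with p12's `ClassX3M.bsdp_rankZero_of_wuthrichHalf_of_firstUnitIndex_of_x3Partner[_odd]`
  (`PotMultX3PartnerMinimal` §2) the schema `hG : CongruentLambdaShift W W₁ p e` AND the partner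
  certificate `hcert₁` are NO LONGER hypotheses — on reducible rows, where EPW 2006 does not apply,
  this is the first rank-`0` closure path from a congruence whose every per-pair input is a
  certificate (record at `E`, `TorsionIso`, `Σ₀`, `p ∤ #E(ℚ)_tors`) or a rank (`r₁ ≤ rank E₁(ℚ)`).
* §2 X4(M) ∧ surj(p) ∧ `r_an = 0` row, X4(M) ∧ surj or X4♯(G-ord) ∩ `I₀*` ∧ surj partner of rank
  `≥ r₁`: EPW-free SECOND SOURCE beside g4's / g5's `…_of_epw_of_{mult,gord}Partner_of_congr`.

What is NOT claimed: anything at the partner beyond its class, image (X4) and rank; the (G-ord)-ROW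
twins; `r_an = 1`; `p = 2`. X3♯(M) / X4(M) stay CONSTRUCTION-SHAPED; nothing booked.

References: [GreenbergVatsal2000] §2; [Wuthrich2014] Thm. 16; [Kato2004Asterisque] Thm. 17.4 (3);
[Delbourgo1998] Prop. 4; [Pal2012] Thm. 3.2; [Miller2011LMS] Def. 1.1; [SilvermanATAEC1994] V.5.3–5.4.
-/

set_option autoImplicit false

noncomputable section

open scoped Classical MatrixGroups ModularForm NumberField

namespace Summit.BirchSwinnertonDyer.Rank1Residual.AdditivePotMult

open CongruenceSubgroup WeierstrassCurve NumberField IsDedekindDomain Field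
  Literature.NumberTheory.EllipticCurves
  Literature.NumberTheory.EllipticCurves.ModularForms
  Literature.NumberTheory.EllipticCurves.Rank1Residual
  Literature.NumberTheory.EllipticCurves.Rank1Residual.Typed
  Literature.NumberTheory.EllipticCurves.GreenbergSelmer
  Literature.NumberTheory.EllipticCurves.Greenberg1999
  Literature.NumberTheory.EllipticCurves.Wuthrich2014
  Literature.NumberTheory.EllipticCurves.GreenbergVatsal2000
  Literature.NumberTheory.GaloisRepresentations
  Summit.BirchSwinnertonDyer.Rank1Residual.Additive
  Summit.BirchSwinnertonDyer.Rank1Residual.Additive.CensusQ6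
  Summit.BirchSwinnertonDyer.Rank1Residual.X1.MuLambda
  Summit.BirchSwinnertonDyer.Rank1Residual.X11a
  Summit.BirchSwinnertonDyer.Rank1Residual.Iwasawa

open Summit.BirchSwinnertonDyer.Rank1Residual.X1.CongruenceTransfer (TorsionIso CongruentLambdaShift)

variable {W W₁ : WeierstrassCurve ℚ} [W.IsElliptic] [W.IsGloballyMinimal] [W₁.IsElliptic]
  [W₁.IsGloballyMinimal] {p : ℕ} [hp : Fact p.Prime]

/-! ### §1 X3♯(M) ∧ `r_an = 0` row (`ρ̄` REDUCIBLE): `BSD(E,p)` from the record + a GV partner of enough rank -/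

/-- **X3♯(M) ∧ `r_an = 0`, EVERY odd `p`, X3♯(M) partner: `BSD(E,p)` ⟸ the record at index `b` + a GV
congruent partner of rank `≥ r₁`** — `E = W` X3♯(M) with `r_an = 0` and the census record (parity of
`(p−1)/2`) at index `b`; partner `E₁ = W₁` X3♯(M) with `r₁ ≤ rank E₁(ℚ)` (NO certificate at `E₁`);
`E[p] ≅ E₁[p]` (`TorsionIso`); ONE census bit `p ∤ #E(ℚ)_tors`; `Σ₀ ∌ p` outside which both are good;
`b ≤ r₁ + Σ_{w∈Σ₀} (δ(E₁,w) − δ(E,w))`. p12's `…_of_budget` over FILE 2's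
`ClassX3M.budgetLeLambdaAt_of_gv_of_multPartner_of_rank`. PER PAIR; X3♯(M) stays CONSTRUCTION-SHAPED;
nothing booked. [cite: Wuthrich2014, Thm. 16 (p. 397)]
[cite: GreenbergVatsal2000, §2 Prop. (2.8) with Remark (2.9), Cor. (2.3), Prop. (2.4), pp. 26–27 (arXiv:math/9906215)]
[cite: Delbourgo1998, Prop. 4 (p. 144)] [cite: Pal2012, Thm. 3.2] [cite: Miller2011LMS, Def. 1.1]
[cite: SilvermanATAEC1994, Ch. V Thm. 5.3, Cor. 5.4] -/
theorem ClassX3M.bsdp_rankZero_of_wuthrichHalf_of_firstUnitIndex_of_gv_of_x3Partner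
    (hW16 : Wuthrich2014.thm16_halfEigenCharIdeal_dvd_cyclotomicPrime)
    (hDel : Delbourgo1998.prop4_rankZero_pow_dvd_constantCoeff)
    (hDelX : Delbourgo1998.prop4_rankZero_constantCoeff_eq_unit_mul_of_potMult)
    (hPal : Pal2012.thm32_sqrt_mul_realPeriodRat_twist_eq_of_prime_one_mod_four)
    (hGZK : rank_eq_analyticRank_of_analyticRank_le_one) (hmod : hasEntireLFunction_rat)
    (hmodD : nonempty_modularParametrizationData)
    (hGV : muLambdaAlg_transfer_of_torsionIso_potOrd_of_not_dvd_torsionOrder)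
    (hT40 : Silverman1994_thmV53_tateUniformisation.{0})
    (hT41 : Silverman1994_thmV53_corV54_tateUniformisation.{0})
    (hX : ClassX3M W p) (hr : W.analyticRank = 0) {b : ℕ}
    (hrec : (p % 4 = 1 → MultFirstUnitIndexAt W p b) ∧ (p % 4 = 3 → MultOddFirstUnitIndexAt W p b))
    (hX₁ : ClassX3M W₁ p) {r₁ : ℕ} (hr₁ : r₁ ≤ W₁.mordellWeilRank)
    (htors : ¬ p ∣ W.torsionOrder) (hT : TorsionIso W W₁ p)
    (S₀ : Finset (HeightOneSpectrum (𝓞 ℚ))) (hS₀ : ∀ w ∈ S₀, ((p : ℕ) : 𝓞 ℚ) ∉ w.asIdeal)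
    (hS : ∀ w : HeightOneSpectrum (𝓞 ℚ), w ∉ S₀ → ((p : ℕ) : 𝓞 ℚ) ∉ w.asIdeal →
      W.HasGoodReductionAt w)
    (hS₁ : ∀ w : HeightOneSpectrum (𝓞 ℚ), w ∉ S₀ → ((p : ℕ) : 𝓞 ℚ) ∉ w.asIdeal →
      W₁.HasGoodReductionAt w)
    (hb : (b : ℤ) ≤ r₁ + ∑ w ∈ S₀, ((delta W₁ p w : ℤ) - (delta W p w : ℤ))) : BSDp W p :=
  hX.bsdp_rankZero_of_wuthrichHalf_of_firstUnitIndex_of_budget hW16 hDel hDelX hPal hGZK hmod hmodD hr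
    hrec
    (hX.budgetLeLambdaAt_of_gv_of_multPartner_of_rank hGV hW16 hmodD hT40 hT41 hX₁ hr₁ htors hT S₀ hS₀
      hS hS₁ hb)

/-- **Pal-free odd form: X3♯(M) ∧ `r_an = 0`, `p ≡ 3 (mod 4)` (`p = 3` included), X3♯(M) partner of
rank `≥ r₁`** — odd record `MultOddFirstUnitIndexAt W p b` + GV partner ⟹ `BSD(E,p)`; NO `hPal`, NO
image hypothesis, NO partner certificate. [cite: Wuthrich2014, Thm. 16 (p. 397)]
[cite: GreenbergVatsal2000, §2 Prop. (2.8) with Remark (2.9), Cor. (2.3), Prop. (2.4), pp. 26–27 (arXiv:math/9906215)]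
[cite: Delbourgo1998, Prop. 4 (p. 144)] [cite: Miller2011LMS, Def. 1.1] [cite: SilvermanATAEC1994, Ch. V Thm. 5.3, Cor. 5.4] -/
theorem ClassX3M.bsdp_rankZero_of_wuthrichHalf_of_firstUnitIndex_of_gv_of_x3Partner_odd
    (hW16 : Wuthrich2014.thm16_halfEigenCharIdeal_dvd_cyclotomicPrime)
    (hDel : Delbourgo1998.prop4_rankZero_pow_dvd_constantCoeff)
    (hDelX : Delbourgo1998.prop4_rankZero_constantCoeff_eq_unit_mul_of_potMult)
    (hGZK : rank_eq_analyticRank_of_analyticRank_le_one) (hmod : hasEntireLFunction_rat)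
    (hmodD : nonempty_modularParametrizationData)
    (hGV : muLambdaAlg_transfer_of_torsionIso_potOrd_of_not_dvd_torsionOrder)
    (hT40 : Silverman1994_thmV53_tateUniformisation.{0})
    (hT41 : Silverman1994_thmV53_corV54_tateUniformisation.{0})
    (hX : ClassX3M W p) (hp4 : p % 4 = 3) (hr : W.analyticRank = 0) {b : ℕ}
    (hrec : MultOddFirstUnitIndexAt W p b)
    (hX₁ : ClassX3M W₁ p) {r₁ : ℕ} (hr₁ : r₁ ≤ W₁.mordellWeilRank)
    (htors : ¬ p ∣ W.torsionOrder) (hT : TorsionIso W W₁ p)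
    (S₀ : Finset (HeightOneSpectrum (𝓞 ℚ))) (hS₀ : ∀ w ∈ S₀, ((p : ℕ) : 𝓞 ℚ) ∉ w.asIdeal)
    (hS : ∀ w : HeightOneSpectrum (𝓞 ℚ), w ∉ S₀ → ((p : ℕ) : 𝓞 ℚ) ∉ w.asIdeal →
      W.HasGoodReductionAt w)
    (hS₁ : ∀ w : HeightOneSpectrum (𝓞 ℚ), w ∉ S₀ → ((p : ℕ) : 𝓞 ℚ) ∉ w.asIdeal →
      W₁.HasGoodReductionAt w)
    (hb : (b : ℤ) ≤ r₁ + ∑ w ∈ S₀, ((delta W₁ p w : ℤ) - (delta W p w : ℤ))) : BSDp W p :=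
  hX.bsdp_rankZero_of_wuthrichHalf_of_firstUnitIndex_of_budget_odd hW16 hDel hDelX hGZK hmod hmodD hp4 hr
    hrec
    (hX.budgetLeLambdaAt_of_gv_of_multPartner_of_rank hGV hW16 hmodD hT40 hT41 hX₁ hr₁ htors hT S₀ hS₀
      hS hS₁ hb)

/-- **`p = 3` specialisation (the N10 X3♯(M) rows at `3`):** X3♯(M)@3 ∧ `r_an = 0`, odd record
`MultOddFirstUnitIndexAt W 3 b` + an X3♯(M)@3 partner of rank `≥ r₁` with `E[3] ≅ E₁[3]`,
`3 ∤ #E(ℚ)_tors`, `Σ₀`, `b ≤ r₁ + Σ(δ₁ − δ)` ⟹ `BSD(E,3)`; NO `hPal`, NO certificate at `E₁`.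
[cite: Wuthrich2014, Thm. 16 (p. 397)] [cite: GreenbergVatsal2000, §2 Prop. (2.8) with Remark (2.9), pp. 26–27 (arXiv:math/9906215)]
[cite: Delbourgo1998, Prop. 4 (p. 144)] [cite: Miller2011LMS, Def. 1.1] -/
theorem ClassX3M.bsdp_three_rankZero_of_wuthrichHalf_of_firstUnitIndex_of_gv_of_x3Partner
    [Fact (Nat.Prime 3)]
    (hW16 : Wuthrich2014.thm16_halfEigenCharIdeal_dvd_cyclotomicPrime)
    (hDel : Delbourgo1998.prop4_rankZero_pow_dvd_constantCoeff)
    (hDelX : Delbourgo1998.prop4_rankZero_constantCoeff_eq_unit_mul_of_potMult)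
    (hGZK : rank_eq_analyticRank_of_analyticRank_le_one) (hmod : hasEntireLFunction_rat)
    (hmodD : nonempty_modularParametrizationData)
    (hGV : muLambdaAlg_transfer_of_torsionIso_potOrd_of_not_dvd_torsionOrder)
    (hT40 : Silverman1994_thmV53_tateUniformisation.{0})
    (hT41 : Silverman1994_thmV53_corV54_tateUniformisation.{0})
    (hX : ClassX3M W 3) (hr : W.analyticRank = 0) {b : ℕ} (hrec : MultOddFirstUnitIndexAt W 3 b)
    (hX₁ : ClassX3M W₁ 3) {r₁ : ℕ} (hr₁ : r₁ ≤ W₁.mordellWeilRank)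
    (htors : ¬ 3 ∣ W.torsionOrder) (hT : TorsionIso W W₁ 3)
    (S₀ : Finset (HeightOneSpectrum (𝓞 ℚ))) (hS₀ : ∀ w ∈ S₀, ((3 : ℕ) : 𝓞 ℚ) ∉ w.asIdeal)
    (hS : ∀ w : HeightOneSpectrum (𝓞 ℚ), w ∉ S₀ → ((3 : ℕ) : 𝓞 ℚ) ∉ w.asIdeal →
      W.HasGoodReductionAt w)
    (hS₁ : ∀ w : HeightOneSpectrum (𝓞 ℚ), w ∉ S₀ → ((3 : ℕ) : 𝓞 ℚ) ∉ w.asIdeal →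
      W₁.HasGoodReductionAt w)
    (hb : (b : ℤ) ≤ r₁ + ∑ w ∈ S₀, ((delta W₁ 3 w : ℤ) - (delta W 3 w : ℤ))) : BSDp W 3 :=
  hX.bsdp_rankZero_of_wuthrichHalf_of_firstUnitIndex_of_gv_of_x3Partner_odd hW16 hDel hDelX hGZK hmod
    hmodD hGV hT40 hT41 (by decide) hr hrec hX₁ hr₁ htors hT S₀ hS₀ hS hS₁ hb

/-- **X3♯(M) ∧ `r_an = 0`, EVERY odd `p`, X3♯(G-ord) ∩ `I₀*` partner of rank `≥ r₁`: `BSD(E,p)` ⟸ the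
record at index `b` + the GV partner**, mod A40/A41 | `hGrK`; NO certificate at `E₁`. p12's
`…_of_budget` over FILE 2's `ClassX3M.budgetLeLambdaAt_of_gv_of_gordPartner_of_rank`. PER PAIR; nothing
booked. [cite: Wuthrich2014, Thm. 16 (p. 397)]
[cite: GreenbergVatsal2000, §2 Prop. (2.8) with Remark (2.9), Cor. (2.3), Prop. (2.4), pp. 26–27 (arXiv:math/9906215)]
[cite: Delbourgo1998, Prop. 4 (p. 144)] [cite: Pal2012, Thm. 3.2] [cite: Miller2011LMS, Def. 1.1]
[cite: GreenbergLNM1716, Prop. 4.14, §2 Props. 2.2, 2.4 (pp. 73–75)] -/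
theorem ClassX3M.bsdp_rankZero_of_wuthrichHalf_of_firstUnitIndex_of_gv_of_x3GordPartner
    (hW16 : Wuthrich2014.thm16_halfEigenCharIdeal_dvd_cyclotomicPrime)
    (hDel : Delbourgo1998.prop4_rankZero_pow_dvd_constantCoeff)
    (hDelX : Delbourgo1998.prop4_rankZero_constantCoeff_eq_unit_mul_of_potMult)
    (hPal : Pal2012.thm32_sqrt_mul_realPeriodRat_twist_eq_of_prime_one_mod_four)
    (hGZK : rank_eq_analyticRank_of_analyticRank_le_one) (hmod : hasEntireLFunction_rat)
    (hmodD : nonempty_modularParametrizationData)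
    (hGV : muLambdaAlg_transfer_of_torsionIso_potOrd_of_not_dvd_torsionOrder)
    (hGrK : imKummer_ge_strictCondition_goodOrdinary)
    (hT40 : Silverman1994_thmV53_tateUniformisation.{0})
    (hT41 : Silverman1994_thmV53_corV54_tateUniformisation.{0})
    (hX : ClassX3M W p) (hr : W.analyticRank = 0) {b : ℕ}
    (hrec : (p % 4 = 1 → MultFirstUnitIndexAt W p b) ∧ (p % 4 = 3 → MultOddFirstUnitIndexAt W p b))
    (hX₁ : ClassX3Gord W₁ p) (he₁ : semistabilityIndex W₁ p = 2) {r₁ : ℕ}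
    (hr₁ : r₁ ≤ W₁.mordellWeilRank) (htors : ¬ p ∣ W.torsionOrder) (hT : TorsionIso W W₁ p)
    (S₀ : Finset (HeightOneSpectrum (𝓞 ℚ))) (hS₀ : ∀ w ∈ S₀, ((p : ℕ) : 𝓞 ℚ) ∉ w.asIdeal)
    (hS : ∀ w : HeightOneSpectrum (𝓞 ℚ), w ∉ S₀ → ((p : ℕ) : 𝓞 ℚ) ∉ w.asIdeal →
      W.HasGoodReductionAt w)
    (hS₁ : ∀ w : HeightOneSpectrum (𝓞 ℚ), w ∉ S₀ → ((p : ℕ) : 𝓞 ℚ) ∉ w.asIdeal →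
      W₁.HasGoodReductionAt w)
    (hb : (b : ℤ) ≤ r₁ + ∑ w ∈ S₀, ((delta W₁ p w : ℤ) - (delta W p w : ℤ))) : BSDp W p :=
  hX.bsdp_rankZero_of_wuthrichHalf_of_firstUnitIndex_of_budget hW16 hDel hDelX hPal hGZK hmod hmodD hr
    hrec
    (hX.budgetLeLambdaAt_of_gv_of_gordPartner_of_rank hGV hGrK hW16 hmodD hT40 hT41 hX₁ he₁ hr₁ htors hT
      S₀ hS₀ hS hS₁ hb)

/-- **Pal-free odd form, X3♯(G-ord) ∩ `I₀*` partner**: X3♯(M) ∧ `r_an = 0`, `p ≡ 3 (mod 4)` (`p = 3`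
included), odd record + GV partner of rank `≥ r₁` ⟹ `BSD(E,p)`, mod A40/A41 | `hGrK`; NO `hPal`.
[cite: Wuthrich2014, Thm. 16 (p. 397)] [cite: GreenbergVatsal2000, §2 Prop. (2.8) with Remark (2.9), pp. 26–27 (arXiv:math/9906215)]
[cite: Delbourgo1998, Prop. 4 (p. 144)] [cite: Miller2011LMS, Def. 1.1] [cite: GreenbergLNM1716, Prop. 4.14, §2 Props. 2.2, 2.4] -/
theorem ClassX3M.bsdp_rankZero_of_wuthrichHalf_of_firstUnitIndex_of_gv_of_x3GordPartner_odd
    (hW16 : Wuthrich2014.thm16_halfEigenCharIdeal_dvd_cyclotomicPrime)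
    (hDel : Delbourgo1998.prop4_rankZero_pow_dvd_constantCoeff)
    (hDelX : Delbourgo1998.prop4_rankZero_constantCoeff_eq_unit_mul_of_potMult)
    (hGZK : rank_eq_analyticRank_of_analyticRank_le_one) (hmod : hasEntireLFunction_rat)
    (hmodD : nonempty_modularParametrizationData)
    (hGV : muLambdaAlg_transfer_of_torsionIso_potOrd_of_not_dvd_torsionOrder)
    (hGrK : imKummer_ge_strictCondition_goodOrdinary)
    (hT40 : Silverman1994_thmV53_tateUniformisation.{0})
    (hT41 : Silverman1994_thmV53_corV54_tateUniformisation.{0})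
    (hX : ClassX3M W p) (hp4 : p % 4 = 3) (hr : W.analyticRank = 0) {b : ℕ}
    (hrec : MultOddFirstUnitIndexAt W p b)
    (hX₁ : ClassX3Gord W₁ p) (he₁ : semistabilityIndex W₁ p = 2) {r₁ : ℕ}
    (hr₁ : r₁ ≤ W₁.mordellWeilRank) (htors : ¬ p ∣ W.torsionOrder) (hT : TorsionIso W W₁ p)
    (S₀ : Finset (HeightOneSpectrum (𝓞 ℚ))) (hS₀ : ∀ w ∈ S₀, ((p : ℕ) : 𝓞 ℚ) ∉ w.asIdeal)
    (hS : ∀ w : HeightOneSpectrum (𝓞 ℚ), w ∉ S₀ → ((p : ℕ) : 𝓞 ℚ) ∉ w.asIdeal →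
      W.HasGoodReductionAt w)
    (hS₁ : ∀ w : HeightOneSpectrum (𝓞 ℚ), w ∉ S₀ → ((p : ℕ) : 𝓞 ℚ) ∉ w.asIdeal →
      W₁.HasGoodReductionAt w)
    (hb : (b : ℤ) ≤ r₁ + ∑ w ∈ S₀, ((delta W₁ p w : ℤ) - (delta W p w : ℤ))) : BSDp W p :=
  hX.bsdp_rankZero_of_wuthrichHalf_of_firstUnitIndex_of_budget_odd hW16 hDel hDelX hGZK hmod hmodD hp4 hr
    hrec
    (hX.budgetLeLambdaAt_of_gv_of_gordPartner_of_rank hGV hGrK hW16 hmodD hT40 hT41 hX₁ he₁ hr₁ htors hT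
      S₀ hS₀ hS hS₁ hb)

/-- **`p = 3` specialisation, X3♯(G-ord) ∩ `I₀*` partner:** X3♯(M)@3 ∧ `r_an = 0`, odd record at index
`b` + an X3♯(G-ord)@3 (`e = 2`) partner of rank `≥ r₁` ⟹ `BSD(E,3)`, mod A40/A41 | `hGrK`; NO `hPal`.
[cite: Wuthrich2014, Thm. 16 (p. 397)] [cite: GreenbergVatsal2000, §2 Prop. (2.8) with Remark (2.9), pp. 26–27 (arXiv:math/9906215)]
[cite: Delbourgo1998, Prop. 4 (p. 144)] [cite: Miller2011LMS, Def. 1.1] -/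
theorem ClassX3M.bsdp_three_rankZero_of_wuthrichHalf_of_firstUnitIndex_of_gv_of_x3GordPartner
    [Fact (Nat.Prime 3)]
    (hW16 : Wuthrich2014.thm16_halfEigenCharIdeal_dvd_cyclotomicPrime)
    (hDel : Delbourgo1998.prop4_rankZero_pow_dvd_constantCoeff)
    (hDelX : Delbourgo1998.prop4_rankZero_constantCoeff_eq_unit_mul_of_potMult)
    (hGZK : rank_eq_analyticRank_of_analyticRank_le_one) (hmod : hasEntireLFunction_rat)
    (hmodD : nonempty_modularParametrizationData)
    (hGV : muLambdaAlg_transfer_of_torsionIso_potOrd_of_not_dvd_torsionOrder)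
    (hGrK : imKummer_ge_strictCondition_goodOrdinary)
    (hT40 : Silverman1994_thmV53_tateUniformisation.{0})
    (hT41 : Silverman1994_thmV53_corV54_tateUniformisation.{0})
    (hX : ClassX3M W 3) (hr : W.analyticRank = 0) {b : ℕ} (hrec : MultOddFirstUnitIndexAt W 3 b)
    (hX₁ : ClassX3Gord W₁ 3) (he₁ : semistabilityIndex W₁ 3 = 2) {r₁ : ℕ}
    (hr₁ : r₁ ≤ W₁.mordellWeilRank) (htors : ¬ 3 ∣ W.torsionOrder) (hT : TorsionIso W W₁ 3)
    (S₀ : Finset (HeightOneSpectrum (𝓞 ℚ))) (hS₀ : ∀ w ∈ S₀, ((3 : ℕ) : 𝓞 ℚ) ∉ w.asIdeal)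
    (hS : ∀ w : HeightOneSpectrum (𝓞 ℚ), w ∉ S₀ → ((3 : ℕ) : 𝓞 ℚ) ∉ w.asIdeal →
      W.HasGoodReductionAt w)
    (hS₁ : ∀ w : HeightOneSpectrum (𝓞 ℚ), w ∉ S₀ → ((3 : ℕ) : 𝓞 ℚ) ∉ w.asIdeal →
      W₁.HasGoodReductionAt w)
    (hb : (b : ℤ) ≤ r₁ + ∑ w ∈ S₀, ((delta W₁ 3 w : ℤ) - (delta W 3 w : ℤ))) : BSDp W 3 :=
  hX.bsdp_rankZero_of_wuthrichHalf_of_firstUnitIndex_of_gv_of_x3GordPartner_odd hW16 hDel hDelX hGZK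
    hmod hmodD hGV hGrK hT40 hT41 (by decide) hr hrec hX₁ he₁ hr₁ htors hT S₀ hS₀ hS hS₁ hb

/-! ### §2 X4(M) ∧ surj(p) ∧ `r_an = 0` row: the EPW-free second source of the rank-`0` ends -/

/-- **X4(M) ∧ surj(p) ∧ `r_an = 0`, EVERY odd `p`, X4(M) ∧ surj partner of rank `≥ r₁`: `BSD(E,p)` ⟸ the
record at index `b` + a GV congruent partner** — `E[p] ≅ E₁[p]` (`TorsionIso`), `Σ₀`, `ρ̄_{E₁,p}` onto,
`r₁ ≤ rank E₁(ℚ)`, `b ≤ r₁ + Σ_{w∈Σ₀} (δ(E₁,w) − δ(E,w))`; p07-g3's `…_of_budget` over FILE 2's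
`ClassX4M.budgetLeLambdaAt_of_gv_of_multPartner_of_rank`. The EPW-free twin of g4's
`…_of_epw_of_multPartner_of_congr`. PER PAIR; X4(M) stays CONSTRUCTION-SHAPED; nothing booked.
[cite: Kato2004Asterisque, Thm. 17.4 (3) (p. 273)]
[cite: GreenbergVatsal2000, §2 Prop. (2.8) with Remark (2.9), Cor. (2.3), Prop. (2.4), pp. 26–27 (arXiv:math/9906215)]
[cite: Delbourgo1998, Prop. 4 (p. 144)] [cite: Pal2012, Thm. 3.2] [cite: Miller2011LMS, Def. 1.1]
[cite: Mazur1977, Ch. III §5, p. 157] [cite: SilvermanATAEC1994, Ch. V Thm. 5.3, Cor. 5.4] -/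
theorem ClassX4M.bsdp_rankZero_of_surj_of_katoHalf_of_firstUnitIndex_of_gv_of_multPartner_of_rank
    (hK : Wuthrich2014.kato_halfEigenCharIdeal_dvd_cyclotomicPrime_of_surjective)
    (hDel : Delbourgo1998.prop4_rankZero_pow_dvd_constantCoeff)
    (hDelX : Delbourgo1998.prop4_rankZero_constantCoeff_eq_unit_mul_of_potMult)
    (hPal : Pal2012.thm32_sqrt_mul_realPeriodRat_twist_eq_of_prime_one_mod_four)
    (hGZK : rank_eq_analyticRank_of_analyticRank_le_one) (hmod : hasEntireLFunction_rat)
    (hmodD : nonempty_modularParametrizationData)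
    (hGV : muLambdaAlg_transfer_of_torsionIso_potOrd_of_not_dvd_torsionOrder)
    (hT40 : Silverman1994_thmV53_tateUniformisation.{0})
    (hT41 : Silverman1994_thmV53_corV54_tateUniformisation.{0})
    (hX : ClassX4M W p) (hsurj : Surj W p) (hr : W.analyticRank = 0) {b : ℕ}
    (hrec : (p % 4 = 1 → MultFirstUnitIndexAt W p b) ∧ (p % 4 = 3 → MultOddFirstUnitIndexAt W p b))
    (hX₁ : ClassX4M W₁ p) (hsurj₁ : Surj W₁ p) {r₁ : ℕ} (hr₁ : r₁ ≤ W₁.mordellWeilRank)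
    (hT : TorsionIso W W₁ p)
    (S₀ : Finset (HeightOneSpectrum (𝓞 ℚ))) (hS₀ : ∀ w ∈ S₀, ((p : ℕ) : 𝓞 ℚ) ∉ w.asIdeal)
    (hS : ∀ w : HeightOneSpectrum (𝓞 ℚ), w ∉ S₀ → ((p : ℕ) : 𝓞 ℚ) ∉ w.asIdeal →
      W.HasGoodReductionAt w)
    (hS₁ : ∀ w : HeightOneSpectrum (𝓞 ℚ), w ∉ S₀ → ((p : ℕ) : 𝓞 ℚ) ∉ w.asIdeal →
      W₁.HasGoodReductionAt w)
    (hb : (b : ℤ) ≤ r₁ + ∑ w ∈ S₀, ((delta W₁ p w : ℤ) - (delta W p w : ℤ))) : BSDp W p :=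
  hX.bsdp_rankZero_of_surj_of_katoHalf_of_firstUnitIndex_of_budget hK hDel hDelX hPal hGZK hmod hmodD
    hsurj hr hrec
    (hX.budgetLeLambdaAt_of_gv_of_multPartner_of_rank hGV hK hmodD hT40 hT41 hX₁ hsurj₁ hr₁ hT S₀ hS₀ hS
      hS₁ hb)

/-- **`p = 3` specialisation (the N11 (M) rows at `3`), X4(M) ∧ surj(3) partner:** X4(M) ∧ surj(3) ∧
`r_an = 0`, odd record `MultOddFirstUnitIndexAt W 3 b` + a GV congruent X4(M) ∧ surj(3) partner of rank
`≥ r₁` ⟹ `BSD(E,3)` (EPW-free; the Pal binder is idle at `3` but kept by the consumed chain).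
[cite: Kato2004Asterisque, Thm. 17.4 (3) (p. 273)] [cite: GreenbergVatsal2000, §2 Prop. (2.8) with Remark (2.9), pp. 26–27 (arXiv:math/9906215)]
[cite: Delbourgo1998, Prop. 4 (p. 144)] [cite: Miller2011LMS, Def. 1.1] -/
theorem ClassX4M.bsdp_three_rankZero_of_surj_of_katoHalf_of_firstUnitIndex_of_gv_of_multPartner_of_rank
    [Fact (Nat.Prime 3)]
    (hK : Wuthrich2014.kato_halfEigenCharIdeal_dvd_cyclotomicPrime_of_surjective)
    (hDel : Delbourgo1998.prop4_rankZero_pow_dvd_constantCoeff)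
    (hDelX : Delbourgo1998.prop4_rankZero_constantCoeff_eq_unit_mul_of_potMult)
    (hPal : Pal2012.thm32_sqrt_mul_realPeriodRat_twist_eq_of_prime_one_mod_four)
    (hGZK : rank_eq_analyticRank_of_analyticRank_le_one) (hmod : hasEntireLFunction_rat)
    (hmodD : nonempty_modularParametrizationData)
    (hGV : muLambdaAlg_transfer_of_torsionIso_potOrd_of_not_dvd_torsionOrder)
    (hT40 : Silverman1994_thmV53_tateUniformisation.{0})
    (hT41 : Silverman1994_thmV53_corV54_tateUniformisation.{0})
    (hX : ClassX4M W 3) (hsurj : Surj W 3) (hr : W.analyticRank = 0) {b : ℕ}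
    (hrec : MultOddFirstUnitIndexAt W 3 b)
    (hX₁ : ClassX4M W₁ 3) (hsurj₁ : Surj W₁ 3) {r₁ : ℕ} (hr₁ : r₁ ≤ W₁.mordellWeilRank)
    (hT : TorsionIso W W₁ 3)
    (S₀ : Finset (HeightOneSpectrum (𝓞 ℚ))) (hS₀ : ∀ w ∈ S₀, ((3 : ℕ) : 𝓞 ℚ) ∉ w.asIdeal)
    (hS : ∀ w : HeightOneSpectrum (𝓞 ℚ), w ∉ S₀ → ((3 : ℕ) : 𝓞 ℚ) ∉ w.asIdeal →
      W.HasGoodReductionAt w)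
    (hS₁ : ∀ w : HeightOneSpectrum (𝓞 ℚ), w ∉ S₀ → ((3 : ℕ) : 𝓞 ℚ) ∉ w.asIdeal →
      W₁.HasGoodReductionAt w)
    (hb : (b : ℤ) ≤ r₁ + ∑ w ∈ S₀, ((delta W₁ 3 w : ℤ) - (delta W 3 w : ℤ))) : BSDp W 3 :=
  hX.bsdp_three_rankZero_of_surj_of_katoHalf_of_firstUnitIndex_of_budget hK hDel hDelX hPal hGZK hmod
    hmodD hsurj hr hrec
    (hX.budgetLeLambdaAt_of_gv_of_multPartner_of_rank hGV hK hmodD hT40 hT41 hX₁ hsurj₁ hr₁ hT S₀ hS₀ hS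
      hS₁ hb)

/-- **X4(M) ∧ surj(p) ∧ `r_an = 0`, EVERY odd `p`, X4♯(G-ord) ∩ `I₀*` ∧ surj partner of rank `≥ r₁`:
`BSD(E,p)` ⟸ the record at index `b` + a GV congruent partner**, mod A40/A41 | `hGrK`; p07-g3's
`…_of_budget` over FILE 2's `ClassX4M.budgetLeLambdaAt_of_gv_of_gordPartner_of_rank`. The EPW-free
twin of g5's `ClassX4M.…_of_epw_of_gordPartner_of_congr` (`MixedCongruentPartnerEPWBSD` §3). PER PAIR;
nothing booked. [cite: Kato2004Asterisque, Thm. 17.4 (3) (p. 273)]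
[cite: GreenbergVatsal2000, §2 Prop. (2.8) with Remark (2.9), Cor. (2.3), Prop. (2.4), pp. 26–27 (arXiv:math/9906215)]
[cite: Delbourgo1998, Prop. 4 (p. 144)] [cite: Pal2012, Thm. 3.2] [cite: Miller2011LMS, Def. 1.1]
[cite: GreenbergLNM1716, §2 Props. 2.2, 2.4 (pp. 73–75)] -/
theorem ClassX4M.bsdp_rankZero_of_surj_of_katoHalf_of_firstUnitIndex_of_gv_of_gordPartner_of_rank
    (hK : Wuthrich2014.kato_halfEigenCharIdeal_dvd_cyclotomicPrime_of_surjective)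
    (hDel : Delbourgo1998.prop4_rankZero_pow_dvd_constantCoeff)
    (hDelX : Delbourgo1998.prop4_rankZero_constantCoeff_eq_unit_mul_of_potMult)
    (hPal : Pal2012.thm32_sqrt_mul_realPeriodRat_twist_eq_of_prime_one_mod_four)
    (hGZK : rank_eq_analyticRank_of_analyticRank_le_one) (hmod : hasEntireLFunction_rat)
    (hmodD : nonempty_modularParametrizationData)
    (hGV : muLambdaAlg_transfer_of_torsionIso_potOrd_of_not_dvd_torsionOrder)
    (hGrK : imKummer_ge_strictCondition_goodOrdinary)
    (hT40 : Silverman1994_thmV53_tateUniformisation.{0})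
    (hT41 : Silverman1994_thmV53_corV54_tateUniformisation.{0})
    (hX : ClassX4M W p) (hsurj : Surj W p) (hr : W.analyticRank = 0) {b : ℕ}
    (hrec : (p % 4 = 1 → MultFirstUnitIndexAt W p b) ∧ (p % 4 = 3 → MultOddFirstUnitIndexAt W p b))
    (hX₁ : ClassX4Gord W₁ p) (he₁ : semistabilityIndex W₁ p = 2) (hsurj₁ : Surj W₁ p) {r₁ : ℕ}
    (hr₁ : r₁ ≤ W₁.mordellWeilRank) (hT : TorsionIso W W₁ p)
    (S₀ : Finset (HeightOneSpectrum (𝓞 ℚ))) (hS₀ : ∀ w ∈ S₀, ((p : ℕ) : 𝓞 ℚ) ∉ w.asIdeal)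
    (hS : ∀ w : HeightOneSpectrum (𝓞 ℚ), w ∉ S₀ → ((p : ℕ) : 𝓞 ℚ) ∉ w.asIdeal →
      W.HasGoodReductionAt w)
    (hS₁ : ∀ w : HeightOneSpectrum (𝓞 ℚ), w ∉ S₀ → ((p : ℕ) : 𝓞 ℚ) ∉ w.asIdeal →
      W₁.HasGoodReductionAt w)
    (hb : (b : ℤ) ≤ r₁ + ∑ w ∈ S₀, ((delta W₁ p w : ℤ) - (delta W p w : ℤ))) : BSDp W p :=
  hX.bsdp_rankZero_of_surj_of_katoHalf_of_firstUnitIndex_of_budget hK hDel hDelX hPal hGZK hmod hmodD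
    hsurj hr hrec
    (hX.budgetLeLambdaAt_of_gv_of_gordPartner_of_rank hGV hGrK hK hmodD hT40 hT41 hX₁ he₁ hsurj₁ hr₁ hT
      S₀ hS₀ hS hS₁ hb)

/-- **`p = 3` specialisation, X4♯(G-ord) ∩ `I₀*` ∧ surj(3) partner:** X4(M) ∧ surj(3) ∧ `r_an = 0`, odd
record at index `b` + a GV congruent X4♯(G-ord)@3 (`e = 2`) ∧ surj(3) partner of rank `≥ r₁` ⟹
`BSD(E,3)`, mod A40/A41 | `hGrK`. [cite: Kato2004Asterisque, Thm. 17.4 (3) (p. 273)]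
[cite: GreenbergVatsal2000, §2 Prop. (2.8) with Remark (2.9), pp. 26–27 (arXiv:math/9906215)]
[cite: Delbourgo1998, Prop. 4 (p. 144)] [cite: Miller2011LMS, Def. 1.1] -/
theorem ClassX4M.bsdp_three_rankZero_of_surj_of_katoHalf_of_firstUnitIndex_of_gv_of_gordPartner_of_rank
    [Fact (Nat.Prime 3)]
    (hK : Wuthrich2014.kato_halfEigenCharIdeal_dvd_cyclotomicPrime_of_surjective)
    (hDel : Delbourgo1998.prop4_rankZero_pow_dvd_constantCoeff)
    (hDelX : Delbourgo1998.prop4_rankZero_constantCoeff_eq_unit_mul_of_potMult)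
    (hPal : Pal2012.thm32_sqrt_mul_realPeriodRat_twist_eq_of_prime_one_mod_four)
    (hGZK : rank_eq_analyticRank_of_analyticRank_le_one) (hmod : hasEntireLFunction_rat)
    (hmodD : nonempty_modularParametrizationData)
    (hGV : muLambdaAlg_transfer_of_torsionIso_potOrd_of_not_dvd_torsionOrder)
    (hGrK : imKummer_ge_strictCondition_goodOrdinary)
    (hT40 : Silverman1994_thmV53_tateUniformisation.{0})
    (hT41 : Silverman1994_thmV53_corV54_tateUniformisation.{0})
    (hX : ClassX4M W 3) (hsurj : Surj W 3) (hr : W.analyticRank = 0) {b : ℕ}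
    (hrec : MultOddFirstUnitIndexAt W 3 b)
    (hX₁ : ClassX4Gord W₁ 3) (he₁ : semistabilityIndex W₁ 3 = 2) (hsurj₁ : Surj W₁ 3) {r₁ : ℕ}
    (hr₁ : r₁ ≤ W₁.mordellWeilRank) (hT : TorsionIso W W₁ 3)
    (S₀ : Finset (HeightOneSpectrum (𝓞 ℚ))) (hS₀ : ∀ w ∈ S₀, ((3 : ℕ) : 𝓞 ℚ) ∉ w.asIdeal)
    (hS : ∀ w : HeightOneSpectrum (𝓞 ℚ), w ∉ S₀ → ((3 : ℕ) : 𝓞 ℚ) ∉ w.asIdeal →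
      W.HasGoodReductionAt w)
    (hS₁ : ∀ w : HeightOneSpectrum (𝓞 ℚ), w ∉ S₀ → ((3 : ℕ) : 𝓞 ℚ) ∉ w.asIdeal →
      W₁.HasGoodReductionAt w)
    (hb : (b : ℤ) ≤ r₁ + ∑ w ∈ S₀, ((delta W₁ 3 w : ℤ) - (delta W 3 w : ℤ))) : BSDp W 3 :=
  hX.bsdp_three_rankZero_of_surj_of_katoHalf_of_firstUnitIndex_of_budget hK hDel hDelX hPal hGZK hmod
    hmodD hsurj hr hrec
    (hX.budgetLeLambdaAt_of_gv_of_gordPartner_of_rank hGV hGrK hK hmodD hT40 hT41 hX₁ he₁ hsurj₁ hr₁ hT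
      S₀ hS₀ hS hS₁ hb)

end Summit.BirchSwinnertonDyer.Rank1Residual.AdditivePotMult

end
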